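import Summits.ResolutionOfSingularities.ResolutionOfSingularities.Theorems.SeparableGaloisGaloisQuotientModelsDefs
import Literature.AlgebraicGeometry.Resolution.AlterationsFunctionField
import HarnessLib

/-!
# Crux `GaloisQuotientModels` (stmt-ResolutionOfSingularities-18955), line `inseparability-foliation-quotient`:
# the de Jong half of stub `stub_multiplicativeDefect`

Route `ResolutionOfSingularities/SeparableGalois`. The open stub `stub_multiplicativeDefect` (MD) asks,
over a perfect field of characteristic `p`, for a de Jong datum `(G, X₁, ρ, π, n)`
(`IsGaloisAlterationOfExponent p n ρ π`) ALL of whose normal level-`n` sandwich models are log regular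
with `G` acting by log automorphisms (the conjecture MULT). This file isolates what is KNOWN in MD: the
datum itself exists by de Jong 1997, Thm. 5.13 — here CONDITIONALLY on the tree's named fact
`DeJong1997_galoisAlterationQuasiProjective` — the only work being the passage from the fact's
element-wise exponents (`a ∈ K(X₁)^G ⇒ a^{qᵐ} ∈ K(X)` for some `m = m(a)`) to a UNIFORM exponent `n`:
`K(X₁)/K(X)` is finite (`IsAlteration.finiteDimensional_functionFieldOver`), so the `K(X)`-subspace
`K(X₁)^G` is spanned by finitely many `aᵢ`, and `{a | a^{pⁿ} ∈ K(X)}` is a `K(X)`-subspace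
(Frobenius is additive) containing them for `n = max m(aᵢ)`. Hence MD = (de Jong 1997, 5.13) + MULT,
and the research content of the line is exactly MULT.
-/

noncomputable section

-- single-problem summit: the doubled namespace component `ResolutionOfSingularities` is forced
set_option linter.dupNamespace false

open CategoryTheory AlgebraicGeometry TopologicalSpace
open Literature.AlgebraicGeometry.Resolution
open Literature.AlgebraicGeometry.Motives Literature.AlgebraicGeometry.Motives.RatFn

namespace Summit.ResolutionOfSingularities.ResolutionOfSingularities.Theorems.GaloisQuotientModels

/-- **Uniform exponent.** Let `K → L` be a field extension of characteristic `p` with `L`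
finite-dimensional over `K`, and `S ⊆ L` a `K`-subspace every element of which has SOME `pᵐ`-th power
in `K`. Then there is ONE `n` with `a^{pⁿ} ∈ K` for all `a ∈ S`: `S` is spanned by finitely many
elements, and `{a | a^{pⁿ} ∈ K}` is a `K`-subspace (Frobenius is additive) containing them for
`n = max`. [folklore] -/
theorem exists_uniform_pow_mem {K L : Type*} [Field K] [Field L] [Algebra K L] (p : ℕ)
    [Fact p.Prime] [CharP L p] [FiniteDimensional K L] (S : Submodule K L)
    (hS : ∀ a ∈ S, ∃ m : ℕ, a ^ p ^ m ∈ Set.range (algebraMap K L)) :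
    ∃ n : ℕ, ∀ a ∈ S, a ^ p ^ n ∈ Set.range (algebraMap K L) := by
  classical
  obtain ⟨s, hs⟩ := (inferInstance : Module.Finite K S)
  -- exponents of the generators
  have hgen : ∀ x : s, ∃ m : ℕ, ((x : S) : L) ^ p ^ m ∈ Set.range (algebraMap K L) :=
    fun x => hS _ (x : S).2
  choose m hm using hgen
  refine ⟨s.attach.sup m, fun a ha => ?_⟩
  set n := s.attach.sup m with hn
  -- the `K`-subspace `T = {a | a^{pⁿ} ∈ K}`
  let T : Submodule K L :=
    { carrier := {a | a ^ p ^ n ∈ Set.range (algebraMap K L)}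
      add_mem' := by
        rintro a b ⟨c, hc⟩ ⟨d, hd⟩
        refine ⟨c + d, ?_⟩
        rw [map_add, hc, hd, add_pow_char_pow]
      zero_mem' := ⟨0, by
        rw [map_zero, zero_pow (pow_ne_zero n (Fact.out : p.Prime).ne_zero)]⟩
      smul_mem' := by
        rintro c a ⟨d, hd⟩
        refine ⟨c ^ p ^ n * d, ?_⟩
        rw [Algebra.smul_def, mul_pow, map_mul, map_pow, hd] }
  -- the generators lie in `T`
  have hsub : ∀ x : s, ((x : S) : L) ∈ T := by
    intro x
    obtain ⟨c, hc⟩ := hm x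
    have hle : m x ≤ n := Finset.le_sup (f := m) (Finset.mem_attach s x)
    refine ⟨c ^ p ^ (n - m x), ?_⟩
    rw [map_pow, hc, ← pow_mul, ← pow_add, Nat.add_sub_cancel' hle]
  -- hence `S ≤ T` (through the span of the generators)
  have hspan : Submodule.span K (S.subtype '' (s : Set S)) ≤ T := by
    rw [Submodule.span_le]
    rintro _ ⟨x, hx, rfl⟩
    exact hsub ⟨x, hx⟩
  have haspan : a ∈ Submodule.span K (S.subtype '' (s : Set S)) := by
    rw [← Submodule.map_span, hs, Submodule.map_subtype_top]
    exact ha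
  exact hspan haspan

/-- **The de Jong half of MD** (de Jong 1997, Thm. 5.13 / Cor. 5.15 through the named fact
`DeJong1997_galoisAlterationQuasiProjective`): over any field of characteristic `p`, every integral
separated finite-type `X` admits a de Jong datum of SOME uniform exponent `n` —
`IsGaloisAlterationOfExponent p n ρ π` (regular integral quasi-projective source, faithful finite `G`,
`G`-invariant alteration, `a ∈ K(X₁)^G ⇒ a^{pⁿ} ∈ π♯K(X)`). The uniformity is `exists_uniform_pow_mem`
applied to the `K(X)`-subspace of `G`-fixed rational functions inside the finite extension
`K(X₁)/K(X)` (`IsAlteration.finiteDimensional_functionFieldOver`). CONDITIONAL on the named fact.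
[cite: DeJong1997, Thm. 5.13 and Cor. 5.15, pp. 619–620] -/
theorem exists_isGaloisAlterationOfExponent_of_deJong1997
    (hdJ : DeJong1997_galoisAlterationQuasiProjective.{0}) (p : ℕ) [Fact p.Prime] (k : Type)
    [Field k] [CharP k p] (X : Scheme.{0}) [IsIntegral X] (f : X ⟶ Spec (.of k)) [IsSeparated f]
    [LocallyOfFiniteType f] [QuasiCompact f] :
    ∃ (G : Type) (_ : Group G) (_ : Finite G) (X₁ : Scheme.{0}) (_ : IsIntegral X₁)
      (ρ : G →* Aut X₁) (π : X₁ ⟶ X) (_ : IsDominant π) (n : ℕ),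
      IsGaloisAlterationOfExponent p n ρ π := by
  obtain ⟨G, _, _, X₁, _, ρ, π, _, hπ, hreg, hρinj, hinv, hfinaff, hd⟩ := hdJ k X f ‹_› ‹_› ‹_›
  -- characteristic `p` of the function fields
  haveI : CharP X.functionField p := by
    haveI : Nonempty (⊤ : X.Opens) := ⟨⟨genericPoint X, trivial⟩⟩
    exact (((X.germToFunctionField ⊤).hom.comp
      ((f.appTop).hom.comp (Scheme.ΓSpecIso (.of k)).inv.hom)).charP_iff_charP p).mp inferInstance
  haveI : ExpChar X.functionField p := ExpChar.prime (Fact.out : p.Prime)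
  have hq : ringExpChar X.functionField = p := ringExpChar.eq X.functionField p
  haveI : CharP (FunctionFieldOver π) p :=
    ((algebraMap X.functionField (FunctionFieldOver π)).charP_iff_charP p).mp inferInstance
  -- `K(X₁)/K(X)` is finite
  haveI : FiniteDimensional X.functionField (FunctionFieldOver π) :=
    hπ.finiteDimensional_functionFieldOver
  -- the `K(X)`-subspace of `G`-fixed rational functions
  let σ : G → FunctionFieldOver π →ₗ[X.functionField] FunctionFieldOver π := fun g =>
    { toFun := fun a => FunctionFieldOver.of π (functionFieldMap (ρ g).hom ((FunctionFieldOver.of π).symm a))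
      map_add' := fun a b => by simp only [map_add]
      map_smul' := fun c a => by
        simp only [Algebra.smul_def, map_mul, RingHom.id_apply, FunctionFieldOver.algebraMap_apply,
          RingEquiv.symm_apply_apply]
        congr 1
        -- `g♯ (π♯ c) = π♯ c` because `ρ g ≫ π = π`
        have e : functionFieldMap ((ρ g).hom ≫ π) = functionFieldMap π := functionFieldMap_congr (hinv g)
        have := congrArg (fun φ => φ c) e
        simp only [functionFieldMap_comp, RingHom.comp_apply] at this
        rw [this] }
  let S : Submodule X.functionField (FunctionFieldOver π) :=
    ⨅ g : G, LinearMap.eqLocus (σ g) LinearMap.id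
  have hmemS : ∀ a : X₁.functionField, (∀ g : G, functionFieldMap (ρ g).hom a = a) ↔
      FunctionFieldOver.of π a ∈ S := by
    intro a
    simp only [S, Submodule.mem_iInf, LinearMap.mem_eqLocus, LinearMap.id_apply]
    refine ⟨fun h g => ?_, fun h g => ?_⟩
    · change FunctionFieldOver.of π (functionFieldMap (ρ g).hom ((FunctionFieldOver.of π).symm
        (FunctionFieldOver.of π a))) = FunctionFieldOver.of π a
      rw [RingEquiv.symm_apply_apply, h g]
    · have := h g
      change FunctionFieldOver.of π (functionFieldMap (ρ g).hom ((FunctionFieldOver.of π).symm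
        (FunctionFieldOver.of π a))) = FunctionFieldOver.of π a at this
      rw [RingEquiv.symm_apply_apply] at this
      exact (FunctionFieldOver.of π).injective this
  -- element-wise exponents on `S`, from (d) of the fact
  have hS : ∀ b ∈ S, ∃ m : ℕ, b ^ p ^ m ∈ Set.range (algebraMap X.functionField (FunctionFieldOver π)) := by
    intro b hb
    obtain ⟨m, c, hc⟩ := hd ((FunctionFieldOver.of π).symm b) ((hmemS _).mpr (by simpa using hb))
    rw [hq] at hc
    refine ⟨m, c, ?_⟩
    rw [FunctionFieldOver.algebraMap_apply, hc, map_pow, RingEquiv.apply_symm_apply]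
  obtain ⟨n, hn⟩ := exists_uniform_pow_mem p S hS
  refine ⟨G, inferInstance, inferInstance, X₁, inferInstance, ρ, π, inferInstance, n,
    ⟨hπ, hreg, hρinj, hinv, hfinaff, ?_⟩⟩
  intro a ha
  obtain ⟨c, hc⟩ := hn (FunctionFieldOver.of π a) ((hmemS a).mp ha)
  refine ⟨c, ?_⟩
  apply (FunctionFieldOver.of π).injective
  rw [map_pow, ← hc, FunctionFieldOver.algebraMap_apply]

end Summit.ResolutionOfSingularities.ResolutionOfSingularities.Theorems.GaloisQuotientModels

end
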